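import Literature.NumberTheory.LFunctions.WeilFirstPrimeCertificateDataC
import Literature.NumberTheory.LFunctions.WeilBlockRows
import HarnessLib

/-!
# First-prime Weil positivity, stage C: row checks 36–38 of the parity-1 block

Part of `weilCert3C.check` (`WeilFirstPrimeCertificateDataC.lean`), evaluated by `decide +kernel` and kept in its own
file for kernel time and memory (each declaration is checked separately). Assembled in
`WeilFirstPrimeCertificateCCheck.lean`. Pure proof file; nothing is asserted.
-/

noncomputable section

namespace Literature.NumberTheory.LFunctions

set_option maxHeartbeats 0 in
/-- Kernel check of row 36 of `D C = I`, parity 1. [folklore] -/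
theorem checkDCRow1_36_weilCert3C : weilCert3C.base.checkDCRow 1 36 = true := by
  decide +kernel

set_option maxHeartbeats 0 in
/-- Kernel check of the dominance of row 36 of `R = S' − UᵀU`, parity 1. [folklore] -/
theorem checkDomRow1_36_weilCert3C : weilCert3C.base.checkDomRow weilCert3CNuData (23264065549356049135287148592400665151/21267647932558653966460912964485513216 : ℚ) 1 36 = true := by
  decide +kernel

set_option maxHeartbeats 0 in
/-- Kernel check of row 37 of `D C = I`, parity 1. [folklore] -/
theorem checkDCRow1_37_weilCert3C : weilCert3C.base.checkDCRow 1 37 = true := by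
  decide +kernel

set_option maxHeartbeats 0 in
/-- Kernel check of the dominance of row 37 of `R = S' − UᵀU`, parity 1. [folklore] -/
theorem checkDomRow1_37_weilCert3C : weilCert3C.base.checkDomRow weilCert3CNuData (23264065549356049135287148592400665151/21267647932558653966460912964485513216 : ℚ) 1 37 = true := by
  decide +kernel

set_option maxHeartbeats 0 in
/-- Kernel check of row 38 of `D C = I`, parity 1. [folklore] -/
theorem checkDCRow1_38_weilCert3C : weilCert3C.base.checkDCRow 1 38 = true := by
  decide +kernel

set_option maxHeartbeats 0 in
/-- Kernel check of the dominance of row 38 of `R = S' − UᵀU`, parity 1. [folklore] -/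
theorem checkDomRow1_38_weilCert3C : weilCert3C.base.checkDomRow weilCert3CNuData (23264065549356049135287148592400665151/21267647932558653966460912964485513216 : ℚ) 1 38 = true := by
  decide +kernel

end Literature.NumberTheory.LFunctions
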